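import Mathlib
import Summits.CriticalPhenomena.Ising3DConformalLimit.Theorems.PrecisionLaplacianTwoPointSpineGlueAxisDecrement
import Literature.Probability.LatticeModels.CriticalTwoPointLower
import HarnessLib

/-!
# TwoPointSpineGlue (route PrecisionLaplacian, item stmt-CriticalPhenomena-4805) — Lipschitz regularity at
# scale of the critical two-point function

Helper file 10.  From the axial decrement bound (`…TwoPointSpineGlueAxisDecrement.axis_decrement_le`:
reflection positivity in the coordinate site mirrors + Messager–Miracle-Solé + the upper envelope
`G(y) ≤ C₁‖y‖^{-s}`), the lattice symmetries and the DIAGONAL Messager–Miracle-Solé inequality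
(`G(x + eᵢ − eⱼ) ≤ G(x)` for `xⱼ ≤ xᵢ`, tree), unit steps in EVERY direction are controlled:

* `unit_step_le` — `|G(w + eⱼ) − G(w)| ≤ C₁ 8^{s+1} 2^{s+1} ‖w‖^{-(s+1)}` for `‖w‖_∞ ≥ 8`;
* `lipschitz_at_scale` — `|G(z') − G(z)| ≤ C₁ 8^{s+1} 4^{s+1} ‖z' − z‖₁ ‖z‖^{-(s+1)}` whenever
  `‖z‖_∞ ≥ 16` and `‖z' − z‖₁ ≤ ‖z‖_∞ / 2`.

This is the equicontinuity-at-scale input of the Tauberian step.  No definitions are introduced.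
-/

noncomputable section

namespace Summit.CriticalPhenomena.Ising3DConformalLimit.Theorems.SpineGlue

open Finset Real Filter Topology Literature.Probability.LatticeModels

section Lipschitz

variable {C₁ s : ℝ}

/-- The sup norm is invariant under a coordinate reflection. -/
theorem norm_update_neg (i : Fin 3) (w : Site 3) : ‖Function.update w i (-w i)‖ = ‖w‖ := by
  apply le_antisymm
  · refine (pi_norm_le_iff_of_nonneg (norm_nonneg _)).2 fun l => ?_
    by_cases hl : l = i
    · subst hl; rw [Function.update_self, norm_neg]; exact norm_le_pi_norm w l
    · rw [Function.update_of_ne hl]; exact norm_le_pi_norm w l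
  · refine (pi_norm_le_iff_of_nonneg (norm_nonneg _)).2 fun l => ?_
    by_cases hl : l = i
    · subst hl
      have := norm_le_pi_norm (Function.update w l (-w l)) l
      rwa [Function.update_self, norm_neg] at this
    · have := norm_le_pi_norm (Function.update w i (-w i)) l
      rwa [Function.update_of_ne hl] at this

/-- A coordinate of maximal modulus: `|w i₀| = ‖w‖` with `‖w‖ = n ∈ ℕ`. -/
theorem exists_coord_eq_norm (w : Site 3) : ∃ (i₀ : Fin 3) (n : ℕ), ‖w‖ = n ∧ |w i₀| = n := by
  obtain ⟨i₀, hi₀⟩ := Site.exists_natAbs_eq_supNorm ⟨0, Finset.mem_univ _⟩ w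
  refine ⟨i₀, Site.supNorm w, Site.norm_eq_supNorm w, ?_⟩
  rw [← hi₀, Int.natCast_natAbs]

/-- **Unit step, core case**: `wⱼ ≥ 0` and a nonnegative maximal coordinate `w_{i₀} = n = ‖w‖ ≥ 4`. -/
theorem unit_step_core
    (hRP : ∀ (i : Fin 3) (m : ℕ) (y : Fin m → Site 3) (c : Fin m → ℝ), (∀ a, 0 < y a i) →
      0 ≤ ∑ a, ∑ b, c a * c b * criticalTwoPoint 3 (y b - Function.update (y a) i (-(y a i))))
    (hGpos : ∀ x : Site 3, 0 < criticalTwoPoint 3 x)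
    (hs : 0 < s) (hup : ∀ y : Site 3, y ≠ 0 → criticalTwoPoint 3 y ≤ C₁ * ‖y‖ ^ (-s))
    (w : Site 3) (j i₀ : Fin 3) {n : ℕ} (hn : 4 ≤ n) (hwj : 0 ≤ w j) (hi₀ : w i₀ = n)
    (hmax : ∀ l, w l ≤ n) :
    0 ≤ criticalTwoPoint 3 w - criticalTwoPoint 3 (w + Pi.single j 1) ∧
      criticalTwoPoint 3 w - criticalTwoPoint 3 (w + Pi.single j 1) ≤
        C₁ * 8 ^ (s + 1) * (n : ℝ) ^ (-(s + 1)) := by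
  by_cases hj : w j = n
  · exact axis_decrement_le (hRP j) hGpos hs hup w hn hj
  · have hij : i₀ ≠ j := fun h => hj (by rw [← h]; exact hi₀)
    have hax := axis_decrement_le (hRP i₀) hGpos hs hup w hn hi₀
    -- diagonal Messager–Miracle-Solé: `G(w + e_{i₀}) ≤ G(w + e_j)`
    have hlt : w j < n := lt_of_le_of_ne (hmax j) hj
    have hdiag := criticalTwoPoint_diag_le (w + Pi.single j 1) hij (by
      simp [hij, hi₀]; omega)
    have heq : w + Pi.single j 1 + Pi.single i₀ 1 - Pi.single j 1 = w + Pi.single i₀ 1 := by abel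
    rw [heq] at hdiag
    -- axial Messager–Miracle-Solé in direction `j`
    have hmono := criticalTwoPoint_add_single_le w j hwj 1
    push_cast at hmono
    exact ⟨by linarith, by linarith [hax.2]⟩

/-- **Unit step with a nonnegative coordinate**: `|G(w + eⱼ) − G(w)| ≤ C₁ 8^{s+1} ‖w‖^{-(s+1)}` for
`wⱼ ≥ 0`, `‖w‖ ≥ 4` (reflect the maximal coordinate to be positive if necessary). -/
theorem unit_step_nonneg_coord
    (hRP : ∀ (i : Fin 3) (m : ℕ) (y : Fin m → Site 3) (c : Fin m → ℝ), (∀ a, 0 < y a i) →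
      0 ≤ ∑ a, ∑ b, c a * c b * criticalTwoPoint 3 (y b - Function.update (y a) i (-(y a i))))
    (hGpos : ∀ x : Site 3, 0 < criticalTwoPoint 3 x)
    (hs : 0 < s) (hup : ∀ y : Site 3, y ≠ 0 → criticalTwoPoint 3 y ≤ C₁ * ‖y‖ ^ (-s))
    (w : Site 3) (j : Fin 3) (hwj : 0 ≤ w j) (hw : 4 ≤ ‖w‖) :
    |criticalTwoPoint 3 (w + Pi.single j 1) - criticalTwoPoint 3 w| ≤
      C₁ * 8 ^ (s + 1) * ‖w‖ ^ (-(s + 1)) := by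
  obtain ⟨i₀, n, hnorm, hi₀⟩ := exists_coord_eq_norm w
  have hn4 : 4 ≤ n := by
    have : (4 : ℝ) ≤ n := hnorm ▸ hw
    exact_mod_cast this
  have hmax : ∀ l, w l ≤ n ∧ -(n : ℤ) ≤ w l := fun l => by
    have h1 : |((w l : ℤ) : ℝ)| ≤ n := by
      have := norm_le_pi_norm w l
      rw [Int.norm_eq_abs, hnorm] at this
      exact this
    have h2 : |w l| ≤ n := by exact_mod_cast h1
    exact ⟨(abs_le.1 h2).2, (abs_le.1 h2).1⟩
  rw [hnorm]
  rcases le_or_gt 0 (w i₀) with hpos | hneg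
  · -- the maximal coordinate is nonnegative
    have hi₀' : w i₀ = n := by rw [abs_of_nonneg hpos] at hi₀; exact hi₀
    obtain ⟨h0, h1⟩ := unit_step_core hRP hGpos hs hup w j i₀ hn4 hwj hi₀' (fun l => (hmax l).1)
    rw [abs_sub_comm, abs_of_nonneg h0]
    exact h1
  · -- reflect the coordinate `i₀` (which is not `j`)
    have hij : i₀ ≠ j := fun h => by rw [h] at hneg; linarith
    set w' : Site 3 := Function.update w i₀ (-w i₀) with hw'
    have hw'i : w' i₀ = n := by
      simp only [hw', Function.update_self]
      rw [abs_of_neg hneg] at hi₀; linarith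
    have hw'j : 0 ≤ w' j := by simp only [hw', Function.update_of_ne (Ne.symm hij)]; exact hwj
    have hmax' : ∀ l, w' l ≤ n := fun l => by
      by_cases hl : l = i₀
      · subst hl; exact hw'i.le
      · simp only [hw', Function.update_of_ne hl]; exact (hmax l).1
    obtain ⟨h0, h1⟩ := unit_step_core hRP hGpos hs hup w' j i₀ hn4 hw'j hw'i hmax'
    have hG1 : criticalTwoPoint 3 w' = criticalTwoPoint 3 w :=
      twoPointPlus_reflection_invariant_holds (criticalBeta_nonneg 3) i₀ w
    have hG2 : criticalTwoPoint 3 (w' + Pi.single j 1) = criticalTwoPoint 3 (w + Pi.single j 1) := by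
      have : w' + Pi.single j 1 =
          Function.update (w + Pi.single j 1) i₀ (-((w + Pi.single j 1 : Site 3) i₀)) := by
        funext l
        by_cases hl : l = i₀
        · subst hl
          simp only [hw', Pi.add_apply, Function.update_self, Pi.single_apply, if_neg hij]
          ring
        · simp only [hw', Pi.add_apply, Function.update_of_ne hl]
      rw [this]; exact twoPointPlus_reflection_invariant_holds (criticalBeta_nonneg 3) i₀ _
    rw [hG1, hG2] at h0 h1
    rw [abs_sub_comm, abs_of_nonneg h0]
    exact h1

/-- **Unit steps in every direction**: `|G(w + eⱼ) − G(w)| ≤ C₁ 8^{s+1} 2^{s+1} ‖w‖^{-(s+1)}` for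
`‖w‖_∞ ≥ 8` (if `wⱼ < 0`, reflect the coordinate `j`: the step becomes a step at `σⱼw − eⱼ`). -/
theorem unit_step_le
    (hRP : ∀ (i : Fin 3) (m : ℕ) (y : Fin m → Site 3) (c : Fin m → ℝ), (∀ a, 0 < y a i) →
      0 ≤ ∑ a, ∑ b, c a * c b * criticalTwoPoint 3 (y b - Function.update (y a) i (-(y a i))))
    (hGpos : ∀ x : Site 3, 0 < criticalTwoPoint 3 x)
    (hs : 0 < s) (hup : ∀ y : Site 3, y ≠ 0 → criticalTwoPoint 3 y ≤ C₁ * ‖y‖ ^ (-s))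
    (w : Site 3) (j : Fin 3) (hw : 8 ≤ ‖w‖) :
    |criticalTwoPoint 3 (w + Pi.single j 1) - criticalTwoPoint 3 w| ≤
      C₁ * 8 ^ (s + 1) * 2 ^ (s + 1) * ‖w‖ ^ (-(s + 1)) := by
  -- `C₁ > 0`
  have hC₁ : 0 < C₁ := by
    have hne : (Pi.single j 1 : Site 3) ≠ 0 := by
      intro h; have := congr_fun h j; simp at this
    have h := hup _ hne
    have hpos := hGpos (Pi.single j 1)
    have hr : 0 < ‖(Pi.single j 1 : Site 3)‖ ^ (-s) := Real.rpow_pos_of_pos (norm_pos_iff.2 hne) _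
    nlinarith
  have hw0 : 0 < ‖w‖ := by linarith
  -- the comparison `‖v‖^{-(s+1)} ≤ 2^{s+1} ‖w‖^{-(s+1)}` for `‖v‖ ≥ ‖w‖ - 1`
  have hcmp : ∀ v : Site 3, ‖w‖ - 1 ≤ ‖v‖ → ‖v‖ ^ (-(s + 1)) ≤ 2 ^ (s + 1) * ‖w‖ ^ (-(s + 1)) := by
    intro v hv
    have hv0 : 0 < ‖w‖ / 2 := by positivity
    have h1 : ‖w‖ / 2 ≤ ‖v‖ := by linarith
    have h2 := Real.rpow_le_rpow_of_nonpos hv0 h1 (by linarith : -(s + 1) ≤ 0)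
    rw [Real.div_rpow hw0.le (by norm_num), Real.rpow_neg (by norm_num : (0:ℝ) ≤ 2), div_inv_eq_mul,
      mul_comm] at h2
    exact h2
  rcases le_or_gt 0 (w j) with hwj | hwj
  · have h := unit_step_nonneg_coord hRP hGpos hs hup w j hwj (by linarith)
    refine h.trans ?_
    have := hcmp w (by linarith)
    calc C₁ * 8 ^ (s + 1) * ‖w‖ ^ (-(s + 1)) ≤ C₁ * 8 ^ (s + 1) * (2 ^ (s + 1) * ‖w‖ ^ (-(s + 1))) :=
          mul_le_mul_of_nonneg_left this (by positivity)
      _ = _ := by ring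
  · -- reflect the coordinate `j`
    set w' : Site 3 := Function.update w j (-w j) - Pi.single j 1 with hw'
    have hw'j : 0 ≤ w' j := by simp [hw']; omega
    have hflip1 : Function.update w j (-w j) = w' + Pi.single j 1 := by simp [hw']
    have hflip2 : Function.update (w + Pi.single j 1) j (-((w + Pi.single j 1 : Site 3) j)) = w' := by
      funext l
      by_cases hl : l = j
      · subst hl; simp [hw']; ring
      · simp [hw', hl]
    have hG1 : criticalTwoPoint 3 w = criticalTwoPoint 3 (w' + Pi.single j 1) := by
      rw [← hflip1]; exact (twoPointPlus_reflection_invariant_holds (criticalBeta_nonneg 3) j w).symm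
    have hG2 : criticalTwoPoint 3 (w + Pi.single j 1) = criticalTwoPoint 3 w' := by
      rw [← hflip2]; exact (twoPointPlus_reflection_invariant_holds (criticalBeta_nonneg 3) j _).symm
    have hnorm' : ‖w‖ - 1 ≤ ‖w'‖ := by
      have h1 : ‖Function.update w j (-w j)‖ = ‖w‖ := norm_update_neg j w
      have h2 : ‖(Pi.single j 1 : Site 3)‖ ≤ 1 := by
        refine (pi_norm_le_iff_of_nonneg zero_le_one).2 fun l => ?_
        by_cases hl : l = j
        · subst hl; simp
        · simp [hl]
      have := norm_sub_norm_le (Function.update w j (-w j)) (Pi.single j 1 : Site 3)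
      rw [h1] at this
      simp only [hw']
      linarith
    have h := unit_step_nonneg_coord hRP hGpos hs hup w' j hw'j (by linarith)
    rw [hG1, hG2, abs_sub_comm]
    refine h.trans ?_
    calc C₁ * 8 ^ (s + 1) * ‖w'‖ ^ (-(s + 1)) ≤ C₁ * 8 ^ (s + 1) * (2 ^ (s + 1) * ‖w‖ ^ (-(s + 1))) :=
          mul_le_mul_of_nonneg_left (hcmp w' hnorm') (by positivity)
      _ = _ := by ring

/-- The sup norm of a lattice vector is at most its `ℓ¹` norm. -/
theorem norm_le_sum_abs (v : Site 3) : ‖v‖ ≤ ∑ l, |((v l : ℤ) : ℝ)| := by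
  refine (pi_norm_le_iff_of_nonneg (Finset.sum_nonneg fun l _ => abs_nonneg _)).2 fun l => ?_
  rw [Int.norm_eq_abs]
  exact Finset.single_le_sum (f := fun l => |((v l : ℤ) : ℝ)|) (fun l _ => abs_nonneg _) (Finset.mem_univ l)

/-- **Lipschitz regularity at scale.** For `‖z‖_∞ ≥ 16` and `‖z' − z‖₁ ≤ ‖z‖_∞ / 2`:
`|G(z') − G(z)| ≤ C₁ 8^{s+1} 4^{s+1} ‖z' − z‖₁ ‖z‖^{-(s+1)}` (walk from `z` to `z'` by unit steps; every
intermediate point has norm `≥ ‖z‖/2`). -/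
theorem lipschitz_at_scale
    (hRP : ∀ (i : Fin 3) (m : ℕ) (y : Fin m → Site 3) (c : Fin m → ℝ), (∀ a, 0 < y a i) →
      0 ≤ ∑ a, ∑ b, c a * c b * criticalTwoPoint 3 (y b - Function.update (y a) i (-(y a i))))
    (hGpos : ∀ x : Site 3, 0 < criticalTwoPoint 3 x)
    (hs : 0 < s) (hup : ∀ y : Site 3, y ≠ 0 → criticalTwoPoint 3 y ≤ C₁ * ‖y‖ ^ (-s))
    (z z' : Site 3) (hz : 16 ≤ ‖z‖) (hdist : (∑ l, |((z' l - z l : ℤ) : ℝ)|) ≤ ‖z‖ / 2) :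
    |criticalTwoPoint 3 z' - criticalTwoPoint 3 z| ≤
      C₁ * 8 ^ (s + 1) * 4 ^ (s + 1) * (∑ l, |((z' l - z l : ℤ) : ℝ)|) * ‖z‖ ^ (-(s + 1)) := by
  set G := criticalTwoPoint 3 with hGdef
  have hz0 : 0 < ‖z‖ := by linarith
  -- constants
  have hC₁ : 0 < C₁ := by
    have hne : (Pi.single 0 1 : Site 3) ≠ 0 := by
      intro h; have := congr_fun h 0; simp at this
    have h := hup _ hne
    have hpos := hGpos (Pi.single 0 1)
    have hr : 0 < ‖(Pi.single 0 1 : Site 3)‖ ^ (-s) := Real.rpow_pos_of_pos (norm_pos_iff.2 hne) _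
    nlinarith
  set K : ℝ := C₁ * 8 ^ (s + 1) * 2 ^ (s + 1) * (2 ^ (s + 1) * ‖z‖ ^ (-(s + 1))) with hK
  have hK0 : 0 ≤ K := by positivity
  -- unit step near `z`: for `‖v‖ ≥ ‖z‖/2`
  have hstep : ∀ (v : Site 3) (l : Fin 3), ‖z‖ / 2 ≤ ‖v‖ → |G (v + Pi.single l 1) - G v| ≤ K := by
    intro v l hv
    have h := unit_step_le hRP hGpos hs hup v l (by linarith)
    refine h.trans ?_
    have hv0 : 0 < ‖z‖ / 2 := by positivity
    have h2 := Real.rpow_le_rpow_of_nonpos hv0 hv (by linarith : -(s + 1) ≤ 0)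
    rw [Real.div_rpow hz0.le (by norm_num), Real.rpow_neg (by norm_num : (0:ℝ) ≤ 2), div_inv_eq_mul,
      mul_comm] at h2
    rw [hK]
    exact mul_le_mul_of_nonneg_left h2 (by positivity)
  -- induction on the `ℓ¹` distance
  have key : ∀ (D : ℕ) (z' : Site 3), (∑ l, (z' l - z l).natAbs) = D → (D : ℝ) ≤ ‖z‖ / 2 →
      |G z' - G z| ≤ K * D := by
    intro D
    induction D with
    | zero =>
      intro z' hD _
      have : z' = z := by
        funext l
        have := Finset.sum_eq_zero_iff.1 hD l (Finset.mem_univ l)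
        omega
      rw [this]; simp
    | succ D ih =>
      intro z' hD hDle
      -- a coordinate where `z'` differs from `z`
      obtain ⟨l, hl⟩ : ∃ l, (z' l - z l).natAbs ≠ 0 := by
        by_contra h
        push Not at h
        have : (∑ l, (z' l - z l).natAbs) = 0 := Finset.sum_eq_zero fun l _ => h l
        omega
      -- move one unit towards `z` in coordinate `l`
      set σ : ℤ := if z l < z' l then 1 else -1 with hσ
      set z'' : Site 3 := z' - Pi.single l σ with hz''
      have hnat : (z'' l - z l).natAbs + 1 = (z' l - z l).natAbs := by
        simp only [hz'', Pi.sub_apply, Pi.single_eq_same, hσ]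
        split_ifs with h
        · omega
        · omega
      have hD'' : (∑ m, (z'' m - z m).natAbs) = D := by
        have hsplit : ∀ w : Site 3, (∑ m, (w m - z m).natAbs) =
            (w l - z l).natAbs + ∑ m ∈ Finset.univ.erase l, (w m - z m).natAbs := fun w =>
          (Finset.add_sum_erase _ _ (Finset.mem_univ l)).symm
        have hrest : ∑ m ∈ Finset.univ.erase l, (z'' m - z m).natAbs =
            ∑ m ∈ Finset.univ.erase l, (z' m - z m).natAbs := by
          refine Finset.sum_congr rfl fun m hm => ?_
          have hml : m ≠ l := Finset.ne_of_mem_erase hm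
          simp [hz'', hml]
        rw [hsplit] at hD ⊢
        rw [hrest]
        omega
      -- norms of `z''` and `z'` are at least `‖z‖/2`
      have hsum_le : ∀ w : Site 3, (∑ m, (w m - z m).natAbs : ℕ) ≤ D + 1 → ‖z‖ / 2 ≤ ‖w‖ := by
        intro w hw
        have h1 : ‖w - z‖ ≤ ∑ m, |((((w - z) m : ℤ)) : ℝ)| := norm_le_sum_abs (w - z)
        have h2 : (∑ m, |((((w - z) m : ℤ)) : ℝ)|) = ((∑ m, (w m - z m).natAbs : ℕ) : ℝ) := by
          push_cast
          refine Finset.sum_congr rfl fun m _ => ?_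
          simp only [Pi.sub_apply, Nat.cast_natAbs, Int.cast_abs, Int.cast_sub]
        have h3 : ‖w - z‖ ≤ D + 1 := by
          rw [h2] at h1
          exact h1.trans (by exact_mod_cast hw)
        have := norm_sub_norm_le z w
        rw [norm_sub_rev] at this
        push_cast at hDle
        linarith
      have hz''n : ‖z‖ / 2 ≤ ‖z''‖ := hsum_le z'' (by rw [hD'']; omega)
      have hz'n : ‖z‖ / 2 ≤ ‖z'‖ := hsum_le z' (by rw [hD])
      -- the induction hypothesis and the last step
      have hih := ih z'' hD'' (by push_cast at hDle ⊢; linarith)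
      have hlast : |G z' - G z''| ≤ K := by
        by_cases h : z l < z' l
        · -- `z' = z'' + e_l`
          have hσ1 : σ = 1 := by simp [hσ, h]
          have heq : z' = z'' + Pi.single l 1 := by rw [hz'', hσ1]; simp
          have := hstep z'' l hz''n
          rwa [← heq] at this
        · -- `z'' = z' + e_l`
          have hσ1 : σ = -1 := by simp [hσ, h]
          have heq : z'' = z' + Pi.single l 1 := by
            rw [hz'', hσ1, Pi.single_neg, sub_neg_eq_add]
          have := hstep z' l hz'n
          rw [← heq] at this
          rwa [abs_sub_comm] at this
      calc |G z' - G z| = |(G z' - G z'') + (G z'' - G z)| := by ring_nf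
        _ ≤ |G z' - G z''| + |G z'' - G z| := abs_add_le _ _
        _ ≤ K + K * D := add_le_add hlast hih
        _ = K * ((D + 1 : ℕ) : ℝ) := by push_cast; ring
  -- apply with `D = ‖z' - z‖₁`
  set D : ℕ := ∑ l, (z' l - z l).natAbs with hDdef
  have hDcast : ((D : ℕ) : ℝ) = ∑ l, |((z' l - z l : ℤ) : ℝ)| := by
    rw [hDdef]; push_cast
    refine Finset.sum_congr rfl fun l _ => ?_
    simp only [Nat.cast_natAbs, Int.cast_abs, Int.cast_sub]
  have h := key D z' rfl (by rw [hDcast]; exact hdist)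
  rw [hDcast] at h
  refine h.trans (le_of_eq ?_)
  rw [hK]
  have : (4 : ℝ) ^ (s + 1) = 2 ^ (s + 1) * 2 ^ (s + 1) := by
    rw [← Real.mul_rpow (by norm_num) (by norm_num)]; norm_num
  rw [this]; ring

end Lipschitz

end Summit.CriticalPhenomena.Ising3DConformalLimit.Theorems.SpineGlue

end
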